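import Literature.NumberTheory.Transcendental.ZudilinOddZeta
import Mathlib.Analysis.SpecialFunctions.Stirling
import HarnessLib

/-!
# Stirling asymptotics of Zudilin's normalising constant `∏_u ((13+2u)n)! / (27n)!⁶`

Topic `Literature/NumberTheory/Transcendental`; analytic companion of `ZudilinOddZeta.lean`
(`Literature.NumberTheory.Transcendental.Zudilin2004.normConst`). Everything here is PROVED; no
definitions, no named facts.

* `tendsto_log_factorial_sub_stirling` — Stirling's formula with the constant, as a limit:
  `log N! − (N log N − N + ½ log(2πN)) → 0` (from Mathlib's `Stirling.tendsto_stirlingSeq_sqrt_pi`);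
* `tendsto_log_factorial_mul_sub` — the same along `N = a n` for a fixed `a ≥ 1`:
  `log (an)! − (a n log n + n (a log a − a) + ½ log n + ½ log(2πa)) → 0`;
* `Zudilin2004.tendsto_log_normConst_sub` — for Zudilin's constant ([Zudilin2004, (8.6) with the
  parameters of Thm. 3], `h₀ − 2hⱼ = (41−2j)n`, `hⱼ − 1 = 27n`), block by block:
  `log normConst n − (Σ_u St_{13+2u}(n) − 6 St_{27}(n)) → 0`, `St_a(n) = a n log n + n(a log a − a)
  + ½ log n + ½ log(2πa)`; summed up this is `78 n log n + C₁ n + 2 log n + C₂ + o(1)` with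
  `C₁ = Σ_{u=1}^{10} ((13+2u) log(13+2u) − (13+2u)) − 6(27 log 27 − 27)` and
  `C₂ = ½ Σ_u log(2π(13+2u)) − 3 log(54π)` — the constants entering the phase `ψ` and the
  amplitude `A` of `Rₙ(nκ) = n⁻⁷ e^{nψ(κ) + A(κ) + o(1)}`.

## References

* [Zudilin2004] W. Zudilin, *Arithmetic of linear forms involving odd zeta values*, J. Théor.
  Nombres Bordeaux 16 (2004), 251–291, §8 (8.6), Lemma 20.
-/

noncomputable section

open Filter Finset Real
open scoped Topology Nat

namespace Literature.NumberTheory.Transcendental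

/-! ### Stirling with the constant, as a limit -/

/-- **Stirling's formula**: `log N! − (N log N − N + ½ log(2πN)) → 0` as `N → ∞`. [folklore] -/
theorem tendsto_log_factorial_sub_stirling :
    Tendsto (fun N : ℕ ↦ Real.log (N ! : ℝ) - (N * Real.log N - N + 1 / 2 * Real.log (2 * π * N)))
      atTop (𝓝 0) := by
  have h1 : Tendsto (fun N : ℕ ↦ Real.log (Stirling.stirlingSeq N)) atTop (𝓝 (Real.log (√π))) :=
    (Real.continuousAt_log (by positivity)).tendsto.comp Stirling.tendsto_stirlingSeq_sqrt_pi
  have h2 : Real.log (√π) = 1 / 2 * Real.log π := by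
    rw [Real.sqrt_eq_rpow, Real.log_rpow Real.pi_pos]
  rw [h2] at h1
  have h3 := h1.sub_const (1 / 2 * Real.log π)
  rw [sub_self] at h3
  refine h3.congr' ?_
  filter_upwards [eventually_ge_atTop 1] with N hN
  have hN : (0 : ℝ) < N := by exact_mod_cast hN
  rw [Stirling.log_stirlingSeq_formula, Real.log_div hN.ne' (Real.exp_pos 1).ne', Real.log_exp,
    Real.log_mul (by norm_num) hN.ne', Real.log_mul (by positivity) hN.ne',
    Real.log_mul (by norm_num) Real.pi_pos.ne']
  ring

/-- Stirling along `N = a n`, `a ≥ 1` fixed: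
`log (an)! − (a n log n + n (a log a − a) + ½ log n + ½ log(2πa)) → 0`. [folklore] -/
theorem tendsto_log_factorial_mul_sub {a : ℕ} (ha : 1 ≤ a) :
    Tendsto (fun n : ℕ ↦ Real.log ((a * n) ! : ℝ) -
      (a * n * Real.log n + n * (a * Real.log a - a) + 1 / 2 * Real.log n +
        1 / 2 * Real.log (2 * π * a))) atTop (𝓝 0) := by
  have hmul : Tendsto (fun n : ℕ ↦ a * n) atTop atTop :=
    tendsto_id.const_mul_atTop' ha
  have h := tendsto_log_factorial_sub_stirling.comp hmul
  refine h.congr' ?_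
  filter_upwards [eventually_ge_atTop 1] with n hn
  have hn : (0 : ℝ) < n := by exact_mod_cast hn
  have ha0 : (0 : ℝ) < a := by exact_mod_cast ha
  simp only [Function.comp_apply]
  push_cast
  have e0 : Real.log ((a : ℝ) * n) = Real.log a + Real.log n := Real.log_mul ha0.ne' hn.ne'
  have e1 : Real.log (2 * π * ((a : ℝ) * n)) = Real.log (2 * π * a) + Real.log n := by
    rw [← mul_assoc, Real.log_mul (by positivity) hn.ne']
  simp only [e0, e1]
  ring

namespace Zudilin2004

/-- `normConst n > 0`. [cite: Zudilin2004, §8 (8.6)] -/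
theorem normConst_pos (n : ℕ) : 0 < (normConst n : ℝ) := by
  unfold normConst
  push_cast
  refine div_pos (prod_pos fun u _ ↦ ?_) (pow_pos ?_ 6) <;> exact_mod_cast Nat.factorial_pos _

/-- `log normConst n = Σ_u log((13+2u)n)! − 6 log (27n)!`. [cite: Zudilin2004, §8 (8.6)] -/
theorem log_normConst (n : ℕ) :
    Real.log (normConst n : ℝ) =
      (∑ u ∈ Icc 1 10, Real.log (((13 + 2 * u) * n) ! : ℝ)) - 6 * Real.log ((27 * n) ! : ℝ) := by
  unfold normConst
  push_cast
  rw [Real.log_div, Real.log_prod, Real.log_pow]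
  · push_cast; ring
  · intro u _; exact_mod_cast (Nat.factorial_pos _).ne'
  · exact (prod_pos fun u _ ↦ by exact_mod_cast Nat.factorial_pos _).ne'
  · exact (pow_pos (by exact_mod_cast Nat.factorial_pos _) 6).ne'

/-- **Stirling asymptotics of the normalising constant**, block by block:
`log normConst n − (Σ_u St_{13+2u}(n) − 6 St_{27}(n)) → 0`, where
`St_a(n) = a n log n + n (a log a − a) + ½ log n + ½ log(2πa)` is Stirling's model of `log (an)!`.
(Summing up: `Σ_u St_{13+2u} − 6 St_{27} = 78 n log n + C₁ n + 2 log n + C₂` with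
`C₁ = Σ_u ((13+2u) log(13+2u) − (13+2u)) − 6(27 log 27 − 27)`, `C₂ = ½ Σ_u log(2π(13+2u)) − 3 log(54π)`,
the constants of the phase `ψ` and amplitude `A` of `Rₙ(nκ)`.) [cite: Zudilin2004, §8 (8.6) and Lemma 20] -/
theorem tendsto_log_normConst_sub :
    Tendsto (fun n : ℕ ↦ Real.log (normConst n : ℝ) -
      ((∑ u ∈ Icc 1 10, (((13 + 2 * u : ℕ) : ℝ) * n * Real.log n +
          n * (((13 + 2 * u : ℕ) : ℝ) * Real.log ((13 + 2 * u : ℕ) : ℝ) - ((13 + 2 * u : ℕ) : ℝ)) +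
          1 / 2 * Real.log n + 1 / 2 * Real.log (2 * π * ((13 + 2 * u : ℕ) : ℝ)))) -
        6 * (((27 : ℕ) : ℝ) * n * Real.log n +
          n * (((27 : ℕ) : ℝ) * Real.log ((27 : ℕ) : ℝ) - ((27 : ℕ) : ℝ)) +
          1 / 2 * Real.log n + 1 / 2 * Real.log (2 * π * ((27 : ℕ) : ℝ)))))
      atTop (𝓝 0) := by
  have hnum : ∀ u ∈ Icc 1 10, Tendsto (fun n : ℕ ↦ Real.log ((((13 + 2 * u) * n) !) : ℝ) -
      (((13 + 2 * u : ℕ) : ℝ) * n * Real.log n +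
        n * (((13 + 2 * u : ℕ) : ℝ) * Real.log ((13 + 2 * u : ℕ) : ℝ) - ((13 + 2 * u : ℕ) : ℝ)) +
        1 / 2 * Real.log n + 1 / 2 * Real.log (2 * π * ((13 + 2 * u : ℕ) : ℝ))))
      atTop (𝓝 0) := fun u _ ↦ tendsto_log_factorial_mul_sub (a := 13 + 2 * u) (by omega)
  have hden := tendsto_log_factorial_mul_sub (a := 27) (by norm_num)
  have hsum := tendsto_finsetSum (Icc 1 10) hnum
  rw [sum_const_zero] at hsum
  have h := hsum.sub (hden.const_mul 6)
  rw [mul_zero, sub_zero] at h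
  refine h.congr fun n ↦ ?_
  rw [log_normConst, sum_sub_distrib]
  ring

end Zudilin2004

end Literature.NumberTheory.Transcendental
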